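import Literature.NumberTheory.Transcendental.KZDilationBakerSectorComplex
import HarnessLib

/-!
# The Liouville sector of the dilation pencil, IV-a: summing twisted-diagonal kernels

A bookkeeping lemma shared by the sector lifts of the dilation lifting problem at `1` (route
`KontsevichZagierPeriods/LiftingCriteria`, crux `DilationLiftAtOne`): given a one-variable Nash
function `τ` on `(a,b) ⊇ [0,1]`, real algebraic weights `aR_j, aI_j` and two finite families of Nash
kernels `KL_j` on `VL_j`, `KA_j` on `VA_j` (open sets containing `[0,1] × [0,1]` in the `vecCons`
format), the kernel `K(p) = τ(p₀) + Σ_j (aR_j KL_j(p) − aI_j KA_j(p))` on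
`V = {p₀ ∈ (a,b)} ∩ ⋂ VL_j ∩ ⋂ VA_j` is Nash, and its twisted-diagonal integral is
`τ(ϖ) + Σ_j (aR_j ∫ KL_j − aI_j ∫ KA_j)` (`exists_sum_kernel`). Extracted verbatim from the proof of
`KZ.dilationBakerSectorComplex_lift`.

Everything is proved; no `def`, no named fact.

## References
* M. Kontsevich, D. Zagier, *Periods* (2001), §1.2. [`KontsevichZagier2001`]
-/

noncomputable section

open Set MeasureTheory Filter MvPolynomial
open scoped BigOperators Topology
open Literature.ModelTheory.ExponentialFields

namespace Literature.NumberTheory.Transcendental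

namespace KZ.LiouvilleSector

open KZ.DilationLogSector

/-- **Summing twisted-diagonal kernels.** See the module docstring.
[cite: KontsevichZagier2001, §1.2] -/
theorem exists_sum_kernel {ι : Type} [Fintype ι] {a b : ℝ} (ha : a < 0) (hb : 1 < b)
    (hI : IsSemialgebraic ℚ {t : Fin 1 → ℝ | t 0 ∈ Ioo a b}) {τ : ℝ → ℝ}
    (hτs : IsSemialgebraicFunOn ℚ {t : Fin 1 → ℝ | t 0 ∈ Ioo a b} (fun t => τ (t 0)))
    (hτa : ∀ x ∈ Ioo a b, AnalyticAt ℝ τ x)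
    {aR aI : ι → ℝ} (haR : ∀ j, IsAlgebraic ℚ (aR j)) (haI : ∀ j, IsAlgebraic ℚ (aI j))
    {KL KA : ι → (Fin 2 → ℝ) → ℝ} {VL VA : ι → Set (Fin 2 → ℝ)}
    (hVLo : ∀ j, IsOpen (VL j))
    (hVLc : ∀ j, ∀ ϖ ∈ Icc (0:ℝ) 1, ∀ x ∈ Set.pi Set.univ (fun _ : Fin 1 => Icc (0:ℝ) 1),
      Matrix.vecCons ϖ x ∈ VL j)
    (hKLs : ∀ j, IsSemialgebraicFunOn ℚ (VL j) (KL j)) (hKLa : ∀ j, AnalyticOnNhd ℝ (KL j) (VL j))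
    (hVAo : ∀ j, IsOpen (VA j))
    (hVAc : ∀ j, ∀ ϖ ∈ Icc (0:ℝ) 1, ∀ x ∈ Set.pi Set.univ (fun _ : Fin 1 => Icc (0:ℝ) 1),
      Matrix.vecCons ϖ x ∈ VA j)
    (hKAs : ∀ j, IsSemialgebraicFunOn ℚ (VA j) (KA j)) (hKAa : ∀ j, AnalyticOnNhd ℝ (KA j) (VA j)) :
    ∃ (K : (Fin 2 → ℝ) → ℝ) (V : Set (Fin 2 → ℝ)), IsOpen V ∧
      (∀ ϖ ∈ Icc (0:ℝ) 1, ∀ x ∈ Set.pi Set.univ (fun _ : Fin 1 => Icc (0:ℝ) 1),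
        Matrix.vecCons ϖ x ∈ V) ∧
      IsSemialgebraicFunOn ℚ V K ∧ AnalyticOnNhd ℝ K V ∧
      ∀ ϖ ∈ Icc (0:ℝ) 1,
        (∫ y in Set.pi Set.univ (fun _ : Fin 1 => Icc (0:ℝ) 1), K (Matrix.vecCons ϖ (ϖ • y))) =
          τ ϖ + ∑ j, (aR j *
              (∫ y in Set.pi Set.univ (fun _ : Fin 1 => Icc (0:ℝ) 1), KL j (Matrix.vecCons ϖ (ϖ • y))) -
            aI j * (∫ y in Set.pi Set.univ (fun _ : Fin 1 => Icc (0:ℝ) 1),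
              KA j (Matrix.vecCons ϖ (ϖ • y)))) := by
  classical
  have hsub : Icc (0:ℝ) 1 ⊆ Ioo a b := fun x hx => ⟨ha.trans_le hx.1, hx.2.trans_lt hb⟩
  set Vt : Set (Fin 2 → ℝ) := {p : Fin 2 → ℝ | p 0 ∈ Ioo a b} ∩ ((⋂ j, VL j) ∩ ⋂ j, VA j) with hVt
  set Kt : (Fin 2 → ℝ) → ℝ := fun pt => τ (pt 0) + ∑ j, (aR j * KL j pt - aI j * KA j pt) with hKt
  have hVtI : IsSemialgebraic ℚ {p : Fin 2 → ℝ | p 0 ∈ Ioo a b} := by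
    simpa using hI.preimage_comp (fun _ : Fin 1 => (0 : Fin 2))
  have hiInter : ∀ {V : ι → Set (Fin 2 → ℝ)}, (∀ j, IsSemialgebraic ℚ (V j)) →
      IsSemialgebraic ℚ (⋂ j, V j) := by
    intro V hV
    have key : ∀ s : Finset ι, IsSemialgebraic ℚ (⋂ j ∈ s, V j) := by
      intro s
      induction s using Finset.induction_on with
      | empty => simp
      | insert j s hj ih =>
        rw [Finset.set_biInter_insert]
        exact (hV j).inter ih
    simpa using key Finset.univ
  have hVts : IsSemialgebraic ℚ Vt :=
    hVtI.inter ((hiInter fun j => IsSemialgebraicFunOn.isSemialgebraic_holds (hKLs j)).inter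
      (hiInter fun j => IsSemialgebraicFunOn.isSemialgebraic_holds (hKAs j)))
  have hVtL : ∀ j, Vt ⊆ VL j := fun j x hx => mem_iInter.mp hx.2.1 j
  have hVtA : ∀ j, Vt ⊆ VA j := fun j x hx => mem_iInter.mp hx.2.2 j
  refine ⟨Kt, Vt, ?_, ?_, ?_, ?_, ?_⟩
  · exact (isOpen_Ioo.preimage (continuous_apply 0)).inter
      ((isOpen_iInter_of_finite fun j => hVLo j).inter (isOpen_iInter_of_finite fun j => hVAo j))
  · intro ϖ hϖ x hx
    exact ⟨by simpa using hsub hϖ, mem_iInter.mpr fun j => hVLc j ϖ hϖ x hx,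
      mem_iInter.mpr fun j => hVAc j ϖ hϖ x hx⟩
  · have hproj : IsSemialgebraicMapOn ℚ Vt (fun p : Fin 2 → ℝ => fun _ : Fin 1 => p 0) :=
      IsSemialgebraicMapOn.of_forall hVts fun _ => by
        simpa using isSemialgebraicFunOn_aeval hVts (X 0 : MvPolynomial (Fin 2) ℚ)
    have hmaps : MapsTo (fun p : Fin 2 → ℝ => fun _ : Fin 1 => p 0) Vt
        {t : Fin 1 → ℝ | t 0 ∈ Ioo a b} := fun p hp => hp.1
    have hτV : IsSemialgebraicFunOn ℚ Vt (fun p => τ (p 0)) :=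
      (IsSemialgebraicFunOn.comp_isSemialgebraicMapOn_holds hτs hproj hmaps).congr fun _ _ => rfl
    have hsumV : IsSemialgebraicFunOn ℚ Vt (fun p => ∑ j, (aR j * KL j p - aI j * KA j p)) :=
      IsSemialgebraicFunOn.fun_finsetSum Finset.univ hVts fun j _ =>
        ((isSemialgebraicFunOn_const_of_isAlgebraic hVts (haR j)).fun_mul
          ((hKLs j).mono (hVtL j) hVts)).fun_sub
        ((isSemialgebraicFunOn_const_of_isAlgebraic hVts (haI j)).fun_mul
          ((hKAs j).mono (hVtA j) hVts))
    exact hτV.fun_add hsumV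
  · intro pt hpt
    have h0 : AnalyticAt ℝ (fun p : Fin 2 → ℝ => p 0) pt :=
      (ContinuousLinearMap.proj (R := ℝ) (φ := fun _ : Fin 2 => ℝ) 0).analyticAt pt
    have hτp : AnalyticAt ℝ (fun p : Fin 2 → ℝ => τ (p 0)) pt :=
      AnalyticAt.comp (f := fun q : Fin 2 → ℝ => q 0) (hτa (pt 0) hpt.1) h0
    refine hτp.add ?_
    exact Finset.analyticAt_fun_sum _ fun j _ =>
      (analyticAt_const.mul (hKLa j pt (hVtL j hpt))).sub (analyticAt_const.mul (hKAa j pt (hVtA j hpt)))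
  · intro ϖ hϖ
    have hk0 : ∀ y : Fin 1 → ℝ, (Matrix.vecCons ϖ (ϖ • y) : Fin 2 → ℝ) 0 = ϖ := fun y => by simp
    have htwist : ∀ {K : (Fin 2 → ℝ) → ℝ} {V : Set (Fin 2 → ℝ)},
        (∀ ϖ ∈ Icc (0:ℝ) 1, ∀ x ∈ Set.pi Set.univ (fun _ : Fin 1 => Icc (0:ℝ) 1),
          Matrix.vecCons ϖ x ∈ V) → AnalyticOnNhd ℝ K V →
        IntegrableOn (fun y : Fin 1 → ℝ => K (Matrix.vecCons ϖ (ϖ • y)))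
          (Set.pi Set.univ (fun _ : Fin 1 => Icc (0:ℝ) 1)) volume := by
      intro K V hVc hKa
      refine ContinuousOn.integrableOn_compact (isCompact_univ_pi fun _ => isCompact_Icc) ?_
      have hpath : Continuous fun y : Fin 1 → ℝ => Matrix.vecCons ϖ (ϖ • y) :=
        continuous_const.matrixVecCons (continuous_const_smul ϖ)
      refine hKa.continuousOn.comp hpath.continuousOn fun y hy => hVc ϖ hϖ _ ?_
      rw [Set.mem_univ_pi] at hy ⊢
      intro i
      exact ⟨mul_nonneg hϖ.1 (hy i).1, mul_le_one₀ hϖ.2 (hy i).1 (hy i).2⟩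
    have hkL : ∀ j, IntegrableOn (fun y : Fin 1 → ℝ => aR j * KL j (Matrix.vecCons ϖ (ϖ • y)))
        (Set.pi Set.univ (fun _ : Fin 1 => Icc (0:ℝ) 1)) volume := fun j =>
      (htwist (hVLc j) (hKLa j)).const_mul (aR j)
    have hkA : ∀ j, IntegrableOn (fun y : Fin 1 → ℝ => aI j * KA j (Matrix.vecCons ϖ (ϖ • y)))
        (Set.pi Set.univ (fun _ : Fin 1 => Icc (0:ℝ) 1)) volume := fun j =>
      (htwist (hVAc j) (hKAa j)).const_mul (aI j)
    have hkLA : ∀ j, IntegrableOn (fun y : Fin 1 → ℝ =>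
        aR j * KL j (Matrix.vecCons ϖ (ϖ • y)) - aI j * KA j (Matrix.vecCons ϖ (ϖ • y)))
        (Set.pi Set.univ (fun _ : Fin 1 => Icc (0:ℝ) 1)) volume := fun j => (hkL j).sub (hkA j)
    have hk1 : IntegrableOn (fun y : Fin 1 → ℝ => τ ((Matrix.vecCons ϖ (ϖ • y) : Fin 2 → ℝ) 0))
        (Set.pi Set.univ (fun _ : Fin 1 => Icc (0:ℝ) 1)) volume := by
      simp only [hk0]
      exact integrableOn_const (hs :=
        ne_of_lt (IsCompact.measure_lt_top (isCompact_univ_pi fun _ => isCompact_Icc)))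
    have hk2 : IntegrableOn (fun y : Fin 1 → ℝ => ∑ j,
        (aR j * KL j (Matrix.vecCons ϖ (ϖ • y)) - aI j * KA j (Matrix.vecCons ϖ (ϖ • y))))
        (Set.pi Set.univ (fun _ : Fin 1 => Icc (0:ℝ) 1)) volume :=
      integrable_finsetSum _ fun j _ => hkLA j
    simp only [hKt]
    rw [integral_add hk1 hk2, integral_finsetSum _ fun j _ => hkLA j]
    simp only [hk0, setIntegral_cube_one_const]
    congr 1
    refine Finset.sum_congr rfl fun j _ => ?_
    rw [integral_sub (hkL j) (hkA j), MeasureTheory.integral_const_mul, MeasureTheory.integral_const_mul]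

end KZ.LiouvilleSector

end Literature.NumberTheory.Transcendental
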